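import Summits.ABC.StewartYu.PadicG3Start
import Literature.NumberTheory.Transcendental.Waldschmidt1980Count
import HarnessLib

/-!
# Cell abc-stewartyu, crux `Y07Odd` (stmt-ABC-19658), line `gen3-slab-odd`: the START with the RESTRICTED equation set — only the multi-orders
# `τ` with `τ.2 j₀ = 0` are charged (the direction `j₀` is degenerate: `zγ(w)_{j₀} = 0`, so those equations hold trivially)

`Summits/ABC/StewartYu/PadicG3StartR.lean` — cell `abc-stewartyu` (seat p2-g4, F-odd lead).  Repairs the Siegel COUNT of the frame: `PadicG3Start.start`
charged all `τ ∈ tauSet n T₀` (`≍ X₀·T₀^{n+1}/(n+1)!` equations), but `g3φ … τ x = 0` automatically when `τ.2 j₀ ≥ 1` (`zγ_j₀`); charging only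
`tauSetR n j₀ T₀ = {τ ∈ tauSet n T₀ | τ.2 j₀ = 0}` (`≍ X₀·T₀ⁿ/n!`, Nesterenko's count) is what the record's budget (B1) affords.
`zγ_j₀`, `zγpow_eq_zero_of_ne`, `g3φ_eq_zero_of_ne`, `tauSetR`, `mem_tauSetR`, `card_tauSetR_le_choose` (`≤ C(T+n−1, n)`),
`card_tauSetR_le_pow_div_factorial`, `card_eqsR_le_real`, **`start_restricted`**.  No named fact.

References: Yu. V. Nesterenko, LNM 1819 (2003) (3.30), (4.6); M. Waldschmidt, Acta Arith. 37 (1980) (3.6).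
-/

noncomputable section

open NormedSpace Finset Polynomial
open Literature.NumberTheory.Transcendental
open Literature.NumberTheory.Transcendental.CW77.Setup (Tau tauNorm tauSet)
open scoped Nat

namespace Summit.ABC.StewartYu

/-- The restricted multi-order set `{τ ∈ tauSet n T | τ.2 j₀ = 0}`. [folklore] -/
def tauSetR (n : ℕ) (j₀ : Fin n) (T : ℕ) : Finset (Tau n) := (tauSet n T).filter (fun τ => τ.2 j₀ = 0)

/-- Membership. [folklore] -/
theorem mem_tauSetR {n : ℕ} {j₀ : Fin n} {T : ℕ} {τ : Tau n} : τ ∈ tauSetR n j₀ T ↔ tauNorm τ < T ∧ τ.2 j₀ = 0 := by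
  unfold tauSetR; rw [mem_filter, CW77.Setup.mem_tauSet]

/-- **`#tauSetR n j₀ T ≤ C(T+n−1, n)`** (`n ≥ 1`): move `τ.1` into the free slot `j₀`; the image is an `n`-tuple of sum `< T`. [folklore] -/
theorem card_tauSetR_le_choose {n : ℕ} (hn : 1 ≤ n) (j₀ : Fin n) (T : ℕ) : (tauSetR n j₀ T).card ≤ (T + n - 1).choose n := by
  classical
  -- injection into `{σ : Fin n → ℕ | Σ σ < T}` realised inside `piFinset (range T)`
  set Tg : Finset (Fin n → ℕ) := (Fintype.piFinset fun _ : Fin n => range T).filter (fun σ => ∑ i, σ i < T) with hTg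
  have hmap : ∀ τ ∈ tauSetR n j₀ T, Function.update τ.2 j₀ τ.1 ∈ Tg := by
    intro τ hτ
    rw [mem_tauSetR] at hτ
    have hsum : ∑ i, Function.update τ.2 j₀ τ.1 i = tauNorm τ := by
      unfold tauNorm
      rw [← Finset.sum_erase_add _ _ (mem_univ j₀), ← Finset.sum_erase_add univ τ.2 (mem_univ j₀)]
      · rw [Function.update_self, hτ.2, add_zero]
        have : ∑ x ∈ univ.erase j₀, Function.update τ.2 j₀ τ.1 x = ∑ x ∈ univ.erase j₀, τ.2 x :=
          sum_congr rfl fun x hx => by rw [Function.update_of_ne (ne_of_mem_erase hx)]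
        rw [this]; ring
    rw [hTg, mem_filter, Fintype.mem_piFinset]
    refine ⟨fun i => ?_, by rw [hsum]; exact hτ.1⟩
    rw [mem_range]
    have : Function.update τ.2 j₀ τ.1 i ≤ ∑ k, Function.update τ.2 j₀ τ.1 k := single_le_sum (fun k _ => Nat.zero_le _) (mem_univ i)
    omega
  have hinj : Set.InjOn (fun τ : Tau n => Function.update τ.2 j₀ τ.1) (tauSetR n j₀ T : Set (Tau n)) := by
    intro τ hτ τ' hτ' h
    rw [Finset.mem_coe, mem_tauSetR] at hτ hτ'
    have h' : Function.update τ.2 j₀ τ.1 = Function.update τ'.2 j₀ τ'.1 := h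
    have h1 : τ.1 = τ'.1 := by
      have := congrFun h' j₀; simpa using this
    have h2 : τ.2 = τ'.2 := by
      funext k
      by_cases hk : k = j₀
      · rw [hk, hτ.2, hτ'.2]
      · have := congrFun h' k
        rwa [Function.update_of_ne hk, Function.update_of_ne hk] at this
    exact Prod.ext h1 h2
  have hle : (tauSetR n j₀ T).card ≤ Tg.card := card_le_card_of_injOn _ hmap hinj
  refine hle.trans ?_
  -- count `Tg` by fibres of the sum
  have hTg' : Tg.card ≤ ∑ k ∈ range T, n.multichoose k := by
    have hsub : Tg ⊆ (range T).biUnion (fun k => (Fintype.piFinset fun _ : Fin n => range (k + 1)).filter (fun σ => ∑ i, σ i = k)) := by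
      intro σ hσ
      rw [hTg, mem_filter, Fintype.mem_piFinset] at hσ
      rw [mem_biUnion]
      refine ⟨∑ i, σ i, mem_range.mpr hσ.2, ?_⟩
      rw [mem_filter, Fintype.mem_piFinset]
      refine ⟨fun i => mem_range.mpr ?_, rfl⟩
      have : σ i ≤ ∑ k, σ k := single_le_sum (fun k _ => Nat.zero_le _) (mem_univ i)
      omega
    refine (card_le_card hsub).trans ((card_biUnion_le).trans (sum_le_sum fun k _ => ?_))
    rw [Waldschmidt1980.card_filter_piFinset_sum_eq]
  refine hTg'.trans ?_
  -- hockey stick with `d = n − 1`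
  obtain ⟨d, rfl⟩ : ∃ d, n = d + 1 := ⟨n - 1, by omega⟩
  rcases Nat.eq_zero_or_pos T with rfl | hT
  · simp
  · have h1 : ∑ k ∈ range T, (d + 1).multichoose k = ∑ k ∈ range T, (k + d).choose d := by
      refine Finset.sum_congr rfl fun k _ => ?_
      rw [Nat.multichoose_eq]
      have : d + 1 + k - 1 = k + d := by omega
      rw [this, Nat.choose_symm_add]
    rw [h1]
    have h2 : ∑ k ∈ range T, (k + d).choose d = ∑ k ∈ Icc d (T - 1 + d), k.choose d := by
      rw [Finset.range_eq_Ico]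
      have : (Finset.Icc d (T - 1 + d)) = (Finset.Ico 0 T).image (fun k => k + d) := by
        ext k
        simp only [mem_Icc, mem_image, mem_Ico]
        constructor
        · intro hk; exact ⟨k - d, by omega, by omega⟩
        · rintro ⟨m, hm, rfl⟩; omega
      rw [this, Finset.sum_image (fun a _ b _ h => by omega)]
    rw [h2, Nat.sum_Icc_choose]
    have : T - 1 + d + 1 = T + (d + 1) - 1 := by omega
    rw [this]

/-- `#tauSetR n j₀ T ≤ (T+n−1)ⁿ/n!` (reals). [cite: Waldschmidt1980, (3.6)] -/
theorem card_tauSetR_le_pow_div_factorial {n : ℕ} (hn : 1 ≤ n) (j₀ : Fin n) (T : ℕ) :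
    ((tauSetR n j₀ T).card : ℝ) ≤ (((T + n - 1 : ℕ) : ℝ)) ^ n / n.factorial := by
  have h1 : ((tauSetR n j₀ T).card : ℝ) ≤ ((T + n - 1).choose n : ℝ) := by exact_mod_cast card_tauSetR_le_choose hn j₀ T
  refine h1.trans ?_
  have h2 := Nat.choose_le_pow_div n (T + n - 1) (α := ℝ)
  exact h2

namespace G3Setup

variable {p : ℕ} [Fact p.Prime] (S : G3Setup p)

/-- The direction `j₀` is degenerate: `zγ(w)_{j₀} = 0`. [folklore] -/
theorem zγ_j₀ (w : Fin S.n → ℤ) : S.zγ w S.j₀ = 0 := by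
  unfold zγ
  rw [S.𝔛_pivot]; simp

variable {ι : Type*} (R : ι → ℚ[X]) (v : ι → Fin S.n → ℤ)

/-- `zγpow v i t = 0` when `t j₀ ≥ 1`. [folklore] -/
theorem zγpow_eq_zero_of_ne (i : ι) {t : Fin S.n → ℕ} (ht : t S.j₀ ≠ 0) : S.zγpow v i t = 0 := by
  unfold zγpow
  exact Finset.prod_eq_zero (mem_univ S.j₀) (by rw [S.zγ_j₀]; exact zero_pow ht)

/-- **The equations with `τ.2 j₀ ≥ 1` hold trivially.** [folklore] -/
theorem g3φ_eq_zero_of_ne (B : Finset ι) (pv : ι → ℤ) {τ : Tau S.n} (hτ : τ.2 S.j₀ ≠ 0) (x : ℤ) : S.g3φ R v B pv τ x = 0 := by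
  unfold g3φ
  exact Finset.sum_eq_zero fun i _ => by rw [S.zγpow_eq_zero_of_ne v i hτ]; ring

/-- `#(Icc(−X,X) ×ˢ tauSetR n j₀ T) ≤ (2X+1)·(T+n−1)ⁿ/n!` (reals). [cite: Nesterenko2003, (4.6); shape only] -/
theorem card_eqsR_le_real (hn : 1 ≤ S.n) (X T : ℕ) :
    ((Icc (-(X : ℤ)) X ×ˢ tauSetR S.n S.j₀ T).card : ℝ) ≤ (2 * (X : ℝ) + 1) * ((((T + S.n - 1 : ℕ) : ℝ)) ^ S.n / (S.n).factorial) := by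
  rw [card_product, Int.card_Icc]
  have h1 : ((X : ℤ) + 1 - -(X : ℤ)).toNat = 2 * X + 1 := by omega
  rw [h1]
  push_cast
  exact mul_le_mul_of_nonneg_left (card_tauSetR_le_pow_div_factorial hn S.j₀ T) (by positivity)

/-- **The START with the restricted equation set** (verbatim `start`, charging only `τ.2 j₀ = 0`). [cite: Nesterenko2003, Prop 3.9, (4.6); shape only] -/
theorem start_restricted (m : ℕ) (s : Fin S.n → ℕ) (L₀ : ℕ) (R₀ : ℕ → ℚ[X]) (X₀ T₀ : ℕ) (hT₀ : 1 ≤ T₀)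
    (hΛm : ‖S.Λ / (S.b S.j₀ : ℚ_[p])‖ ≤ (p : ℝ)⁻¹ ^ (m + 1))
    (E : Finset (ℤ × Tau S.n)) (hEdef : E = Icc (-(X₀ : ℤ)) X₀ ×ˢ tauSetR S.n S.j₀ T₀)
    (hcount : 2 * E.card * ((p - 1) * p ^ m) ≤ (L₀ + 1) * ∏ j, (2 * s j + 1))
    (den₀ : ℤ × Tau S.n → ℕ) (hden₀ : ∀ e ∈ E, 1 ≤ den₀ e) (M₀ : ℤ × Tau S.n → ℤ)
    (hR : ∀ e ∈ E, ∀ ℓ₀ ≤ L₀, ∃ z₀ : ℤ, (den₀ e : ℚ) * (hasseDeriv e.2.1 (R₀ ℓ₀)).eval (e.1 : ℚ) = z₀ ∧ |z₀| ≤ M₀ e)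
    {Xb : ℤ} (hX : ∀ lam ∈ S.box s, ∀ lam' ∈ S.box s, ∀ k, |S.𝔛 (lam - lam') k| ≤ Xb)
    {Amax : ℝ} (hAmax : 1 ≤ Amax)
    (hA : ∀ e ∈ E, (M₀ e : ℝ) * (Xb : ℝ) ^ (∑ k, e.2.2 k) *
      ((MonomialDen.monDen S.α (S.boxExpG (fun j => 2 * s j) e.1) : ℝ)) ^ 2 ≤ Amax) :
    ∃ (𝔏 : Finset (Fin S.n → ℤ)) (lamb : Fin S.n → ℤ) (pv : ℕ × (Fin S.n → ℤ) → ℤ),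
      𝔏 ⊆ S.box s ∧ lamb ∈ 𝔏 ∧
      S.LvInvI (fun i => R₀ i.1) (S.unk L₀ 𝔏) (fun i => i.2 - lamb) (fun _ => 1) pv (fun j => -(s j : ℤ) - lamb j) (fun j => 2 * s j)
        ⌈((S.unk L₀ 𝔏).card : ℝ) * Amax⌉ m {x : ℤ | |x| ≤ (X₀ : ℤ)} T₀ := by
  classical
  have hp : p.Prime := Fact.out
  obtain ⟨𝔏, h𝔏box, htw, hslab, hcard𝔏⟩ := S.exists_slab_box m s
  have hprod : 1 ≤ ∏ j, (2 * s j + 1) := Finset.one_le_prod' fun j _ => by omega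
  have hpm : 0 < (p - 1) * p ^ m := Nat.mul_pos (by have := S.hp3; omega) (pow_pos hp.pos m)
  have h𝔏ne : 𝔏.Nonempty := by
    rw [← Finset.card_pos]
    by_contra h0
    push Not at h0
    have : 𝔏.card = 0 := by omega
    rw [this, mul_zero] at hcard𝔏
    omega
  obtain ⟨lamb, hlamb⟩ := h𝔏ne
  have hE : E.Nonempty := by
    refine ⟨((0 : ℤ), ((0 : ℕ), fun _ => (0 : ℕ))), ?_⟩
    rw [hEdef, mem_product, mem_Icc, mem_tauSetR]
    refine ⟨⟨by omega, by omega⟩, ?_, rfl⟩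
    unfold tauNorm; simp; omega
  have hcard : 2 * E.card ≤ (S.unk L₀ 𝔏).card := by
    rw [S.card_unk]
    have h1 : (L₀ + 1) * ∏ j, (2 * s j + 1) ≤ (L₀ + 1) * ((p - 1) * p ^ m * 𝔏.card) := Nat.mul_le_mul_left _ hcard𝔏
    have h2 : 2 * E.card * ((p - 1) * p ^ m) ≤ ((L₀ + 1) * 𝔏.card) * ((p - 1) * p ^ m) := by
      calc 2 * E.card * ((p - 1) * p ^ m) ≤ (L₀ + 1) * ((p - 1) * p ^ m * 𝔏.card) := hcount.trans h1
        _ = ((L₀ + 1) * 𝔏.card) * ((p - 1) * p ^ m) := by ring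
    exact Nat.le_of_mul_le_mul_right h2 hpm
  have hvbox : ∀ i ∈ S.unk L₀ 𝔏, ∀ j, |(i.2 - lamb) j| ≤ ((2 * s j : ℕ) : ℤ) := by
    intro i hi j
    have hi2 : i.2 ∈ S.box s := h𝔏box ((mem_product.mp (by unfold unk at hi; exact hi)).2)
    have h1 := S.mem_box.mp hi2 j
    have h2 := S.mem_box.mp (h𝔏box hlamb) j
    simp only [Pi.sub_apply]
    rw [abs_le] at h1 h2 ⊢
    push_cast
    constructor <;> omega
  have hRB : ∀ e ∈ E, ∀ i ∈ S.unk L₀ 𝔏,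
      ∃ z₀ : ℤ, (den₀ e : ℚ) * (hasseDeriv e.2.1 (R₀ i.1)).eval (e.1 : ℚ) = z₀ ∧ |z₀| ≤ M₀ e := by
    intro e he i hi
    have hi1 : i.1 ≤ L₀ := by
      unfold unk at hi
      have := (mem_product.mp hi).1
      rw [mem_range] at this; omega
    exact hR e he i.1 hi1
  have hXB : ∀ i ∈ S.unk L₀ 𝔏, ∀ k, |S.𝔛 (i.2 - lamb) k| ≤ Xb := by
    intro i hi k
    unfold unk at hi
    exact hX i.2 (h𝔏box (mem_product.mp hi).2) lamb (h𝔏box hlamb) k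
  obtain ⟨pv, hsupp, hne, hbd, hsol⟩ := S.exists_g3_siegel (fun i : ℕ × (Fin S.n → ℤ) => R₀ i.1) (fun i => i.2 - lamb)
    (S.unk L₀ 𝔏) E hE hcard hvbox den₀ hden₀ M₀ hRB hXB hAmax hA
  refine ⟨𝔏, lamb, pv, h𝔏box, hlamb, ?_⟩
  obtain ⟨i₀, hi₀⟩ := hne
  refine ⟨⟨i₀, hsupp i₀ hi₀, hi₀⟩, fun i _ => hbd i, ?_, ?_, fun _ => Or.inl rfl, ?_, ?_, ?_, ?_⟩
  · intro j
    have h2 := S.mem_box.mp (h𝔏box hlamb) j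
    rw [abs_le] at h2
    push_cast
    constructor <;> omega
  · intro i hi j
    have hi2 : i.2 ∈ S.box s := h𝔏box ((mem_product.mp (by unfold unk at hi; exact hi)).2)
    have h1 := S.mem_box.mp hi2 j
    rw [abs_le] at h1
    simp only [Pi.sub_apply]
    push_cast
    constructor <;> omega
  · intro i hi
    have hi2 : i.2 ∈ 𝔏 := (mem_product.mp (by unfold unk at hi; exact hi)).2
    rw [S.cls_sub_eq_one htw hi2 hlamb]; norm_num
  · intro i hi
    have hi2 : i.2 ∈ 𝔏 := (mem_product.mp (by unfold unk at hi; exact hi)).2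
    exact S.norm_E_sub_le_depth hslab hi2 hlamb hΛm
  · intro i hi i' hi'
    have hi2 : i.2 ∈ 𝔏 := (mem_product.mp (by unfold unk at hi; exact hi)).2
    have hi2' : i'.2 ∈ 𝔏 := (mem_product.mp (by unfold unk at hi'; exact hi')).2
    rw [← S.Lsum_sub]
    have : i.2 - lamb - (i'.2 - lamb) = i.2 - i'.2 := by abel
    rw [this, S.Lsum_sub]
    exact hslab i.2 hi2 i'.2 hi2'
  · -- vanishing: charged equations by Siegel, the others trivially
    intro x hx τ hτ
    have hpvx : pvx (fun _ : ℕ × (Fin S.n → ℤ) => (1 : ℤ)) pv x = pv := by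
      funext i; unfold pvx; rw [one_pow, one_mul]
    rw [hpvx]
    by_cases hj : τ.2 S.j₀ = 0
    · have he : (x, τ) ∈ E := by
        rw [hEdef, mem_product, mem_Icc, mem_tauSetR]
        have hx' : |x| ≤ (X₀ : ℤ) := hx
        rw [abs_le] at hx'
        exact ⟨⟨hx'.1, hx'.2⟩, hτ, hj⟩
      exact hsol (x, τ) he
    · exact S.g3φ_eq_zero_of_ne (fun i : ℕ × (Fin S.n → ℤ) => R₀ i.1) (fun i => i.2 - lamb) (S.unk L₀ 𝔏) pv hj x

end G3Setup

end Summit.ABC.StewartYu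

end
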